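import Summits.BirchSwinnertonDyer.Rank1Residual.Additive.X3RankZeroSemistableTwistFactFree
import Summits.BirchSwinnertonDyer.Rank1Residual.Additive.ChiBranchInputBigImageEven
import Literature.NumberTheory.EllipticCurves.BSDSelmerPConverseSerreProofs
import Literature.NumberTheory.EllipticCurves.Rank1Residual.Typed.CasselsLowerBound
import Literature.NumberTheory.EllipticCurves.Rank1Residual.Typed.X4
import Summits.BirchSwinnertonDyer.Rank1Residual.Additive.QuadraticTwistSurj
import HarnessLib

/-!
# X4 ∧ `r_an = 0` ∧ (semistable twist) at `p ≡ 1 (mod 4)`: `ord_p #Ш(E) ≤ ord_p #Ш_an(E)` from the EVEN `χ_p`-branch of Kato's divisibility for `E♭` (cell `b2b-bsdres`, seat additive-p4, line V9b-even)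

HONEST FRAMING (cell `b2b-bsdres`, run/shared/lean/b2b/bsd-rank1-residual/, verbatim in every
file): the goal of the cell is to DELETE the COMBINATION-SHAPED residual classes of the
Birch–Swinnerton-Dyer formula for ALL analytic-rank `≤ 1` elliptic curves over `ℚ` — "full BSD
formula for every rank `≤ 1` curve in class `C`" assembled STRICTLY from published theorems — so
that the rank-`≤ 1` remainder becomes exactly the CONSTRUCTION-SHAPED classes, which are TYPED
(missing-input `Prop`s), NOT attempted. This is not "finishing BSD". The additive sub-cell (seats
additive-p1…p4) is a RESEARCH ROUTE on the construction-shaped classes X3/X4; no claim beyond the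
stated classes; the label of X4 is UNCHANGED.

Theorems only (no definition, no new named fact). Even-parity twin of `X4RankZeroSemistableTwistOdd.lean`
(p204500): the V9 valuation chain at `p ≡ 1 (mod 4)` (census primes `5, 13, 17`) for an ADDITIVE
curve `E = W ≅ V^{(p)}` whose twist `V = E♭` is good ordinary or multiplicative at `p`, with the
class-agnostic core extracted from the X3 fact-free assembly (`X3RankZeroTwist.missingUpperBoundAt_of_leadingTerm_factFree`,
p204306 — there the image hypothesis enters only through the pointwise leading-term statement):

* `AdditiveTwistEven.missingUpperBoundAt_of_leadingTerm` — `Addv W p`, `r_an = 0`, `W = C • V^{(p)}`,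
  `V` good ordinary or multiplicative, `f` the newform of `V`, `ϖ·Ω_V = Ω⁺_f`, and the pointwise
  [B∘C](0) statement `hLT` ⇒ **`Typed.MissingUpperBoundAt W p`** (`ord_p #Ш(E) ≤ ord_p #Ш_an(E)`)
  from Delbourgo 1998 Prop. 4 (`hDel`), GZK (`hGZK`), modularity (`hmod`) and tree theorems (even
  Birch, the proved Pal relation, `u_p = 1`, `c_p ≤ 4 < p`).
* `X4RankZeroTwistEven.missingUpperBoundAt` — X4 ∧ `r_an = 0` ∧ (semistable twist) ∧ `p ≡ 1 (mod 4)`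
  ∧ `ρ̄_{V,pⁿ}` onto ∀ `n`, granted the typed input `ChiBranchLeadingTermBigImageAt W p`;
  `X4RankZeroTwistEven.missingUpperBoundAt_of_surj` — the image hypothesis is `surj(p)` of `E`
  (`p ≥ 5`: Serre's lemma `serre_hasSurjectiveModNGaloisRep_pow_holds` + twist invariance
  `surj_iff_of_model_twist`); `.bsdp_of_surj_of_shaAn_unit` (**`BSD(E,p)` on the `p ∤ #Ш_an` rows**),
  `.missingPPartAt_iff_lower_of_surj`, `.bsdp_of_surj_of_casselsTate_of_pow_dvd` (Cassels–Tate
  squeeze on the `p ∣ #Ш_an` rows — census: the X4 Ш-only rows at `p = 5` with semistable twist,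
  e.g. `2900d1@5` (`I₀*`), need ONE 5-descent certificate).

WHAT THIS ADDS over the published route (Kim 2026 Thm. 1.8 (6), tree `X4RankZero.padicValNat_shaOrder_le`,
p199532: `ord_p #Ш ≤ ord_p #Ш_an + ord_p ∏c_ℓ`, `p ≥ 5`, `surj(p)`, Manin `p ∤ c_D`): on the
semistable-twist rows the Tamagawa term and the Manin hypothesis disappear — MODULO the typed input.
So on the (M)/(G-ord, e=2, ordinary-twist) X4 rows at `p ≡ 1 (mod 4)` with `p ∣ ∏c_ℓ` (harvest-2
R2 file: at most 51 rows — Kodaira type `Iₙ*`, `n ≥ 1` (38) or `I₀*` (13, those need an ORDINARY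
twist) at `p = 5` with `5 ∣ Tam`) the typed upper half now holds modulo [B'∘C](0) instead of being
absent. Nothing is booked; X4 stays CONSTRUCTION-SHAPED.

References: [Kato2004Asterisque] Thm. 17.4; [Delbourgo1998] Prop. 4; [MazurTateTeitelbaum1986Invent]
§I.14; [SerreAbelianLadic1968] IV §3.4; [SilvermanAEC2009] X.4.14; [Miller2011LMS] Def. 1.1.
-/

noncomputable section

open scoped Classical MatrixGroups ModularForm

open CongruenceSubgroup WeierstrassCurve Literature.NumberTheory.EllipticCurves
  Literature.NumberTheory.EllipticCurves.ModularForms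
  Literature.NumberTheory.EllipticCurves.Rank1Residual

namespace Summit.BirchSwinnertonDyer.Rank1Residual.Additive

section AssemblyEvenBigImage

open IsDedekindDomain NumberField Rat.HeightOneSpectrum
  Literature.NumberTheory.EllipticCurves.Rank1Residual.Typed

variable (W : WeierstrassCurve ℚ) [W.IsElliptic] [W.IsGloballyMinimal] (p : ℕ) [hp : Fact p.Prime]

/-- **Class-agnostic even core (line V9/V9b, rank 0, `p ≡ 1 (mod 4)`).** As
`X3RankZeroTwist.missingUpperBoundAt_of_leadingTerm_factFree` (p204306) but assuming only that
`E = W` is ADDITIVE at `p` (`Addv W p`), not that `E[p]` is reducible: the image hypothesis enters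
only through the pointwise leading-term statement `hLT`. For `W = C • V^{(p)}`, `V` good ordinary or
multiplicative at `p`, `f` the newform of `V`, `ϖ·Ω_V = Ω⁺_f`: Delbourgo 1998 Prop. 4 (`hDel`) +
`hLT` + even Birch + the proved Pal relation + `ord_p u(C) = 0` + `c_p ≤ 4 < p` + GZK + modularity ⇒
**`ord_p #Ш(E) ≤ ord_p #Ш_an(E)`** (`Typed.MissingUpperBoundAt W p`). -/
theorem AdditiveTwistEven.missingUpperBoundAt_of_leadingTerm
    (hDel : Delbourgo1998.prop4_rankZero_pow_dvd_constantCoeff)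
    (hGZK : rank_eq_analyticRank_of_analyticRank_le_one) (hmod : hasEntireLFunction_rat)
    (hp4 : p % 4 = 1) (hr : W.analyticRank = 0) (hadd : Addv W p)
    (V : WeierstrassCurve ℚ) [V.IsElliptic] [V.IsGloballyMinimal]
    (C : VariableChange ℚ) (hC : C • V.quadraticTwist (p : ℚ) = W) (hV : GoodOrd V p ∨ Mult V p)
    {N : ℕ} [NeZero N] {f : CuspForm (Gamma0 N) 2} (hf : IsNewformOf V f)
    (ϖ : ℚ) (hϖ : (ϖ : ℝ) * V.realPeriodRat = plusPeriod f)
    (hLT : ∀ (κ : ZpExtension ℚ p) (γ : Field.absoluteGaloisGroup ℚ),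
      κ.IsCyclotomic → κ.IsTopGenerator γ → IsCyclotomicVariable p γ →
      ∀ D : W.SelmerDualData κ γ, ∃ g ∈ D.charIdeal, ∃ u : ℤ_[p]ˣ,
        ((PowerSeries.constantCoeff g : ℤ_[p]) : ℚ_[p]) =
          ((u : ℤ_[p]) : ℚ_[p]) * (ϖ : ℚ_[p]) * (legendrePlusSymbolSum f p : ℚ_[p])) :
    MissingUpperBoundAt W p := by
  classical
  have hpP : p.Prime := hp.out
  have hp2 : p ≠ 2 := by omega
  have hp5 : 5 ≤ p := five_le_of_prime_of_mod_four_eq_one p hp4 hpP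
  set v₀ : HeightOneSpectrum (𝓞 ℚ) := (primesEquiv (R := 𝓞 ℚ)).symm ⟨p, hp.out⟩ with hv₀
  -- `ord_p u(C) = 0` (the twisted model is `p`-minimal)
  have hC' : C • V.quadraticTwist (((p : ℤ)) : ℚ) = W := by push_cast; exact hC
  have hu : padicValRat p (C.u : ℚ) = 0 :=
    padicValRat_u_eq_zero_of_twist_pm_p p hp2 V W (hV.elim (fun h ↦ Or.inl h.1) Or.inr)
      (Or.inl rfl) C hC'
  -- rank 0: `L(E,1) ≠ 0`, `E(ℚ)` and `Ш` finite
  have hL : W.entireLFunction 1 ≠ 0 := (W.analyticRank_eq_zero_iff_holds (hmod W)).mp hr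
  obtain ⟨hmw, hfin⟩ := hGZK W (by rw [hr]; exact zero_le_one)
  have hmw0 : W.mordellWeilRank = 0 := by rw [hmw, hr]
  haveI : Finite W.sha := hfin
  haveI hE : Finite W.toAffine.Point := W.finite_point_of_rank_zero hmw0
  -- the cyclotomic setting and `X(E/ℚ_∞)`
  obtain ⟨κ, hκ, γ, hγ, hγ'⟩ := exists_isCyclotomic_isTopGenerator_isCyclotomicVariable_holds p
  obtain ⟨D⟩ := W.nonempty_selmerDualData_holds κ γ hγ
  obtain ⟨g, hgmem, u, hg0⟩ := hLT κ γ hκ hγ hγ' D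
  -- [A]: Delbourgo 1998 Prop. 4
  have hGM := typeGOrd_or_padicValRat_j_neg_of_twist W p hp4 V ⟨C, hC⟩ hV
  obtain ⟨-, hdiv⟩ := hDel W p hp2 hadd hGM hr hfin hE κ γ hκ hγ D
  have hdvd := hdiv g hgmem
  -- analytic side (no period fact)
  obtain ⟨ε, hε, hLq⟩ := entireLFunction_one_eq_of_twist_explicit p hmod hp4 V W C hC hadd hf ϖ hϖ
  set S : ℚ := legendrePlusSymbolSum f p with hS
  set q : ℚ := ε * (ϖ * S) / |(C.u : ℚ)| with hq
  have hΩ : (W.realPeriodRat : ℂ) ≠ 0 := by exact_mod_cast W.realPeriodRat_pos_holds.ne'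
  have hq' : W.entireLFunction 1 / (W.realPeriodRat : ℂ) = (q : ℂ) := by
    rw [hLq, mul_div_cancel_right₀ _ hΩ]
  obtain ⟨-, -, -, hshaAn⟩ := Wuthrich2014.shaAn_eq_of_L_one_div_eq hGZK W hL hq'
  -- non-vanishing and the valuation of `q`
  have hua0 : |(C.u : ℚ)| ≠ 0 := abs_ne_zero.mpr C.u.ne_zero
  have hϖS : ϖ * S ≠ 0 := by
    intro h0
    apply hL
    rw [hLq, hq, h0, mul_zero, zero_div, Rat.cast_zero, zero_mul]
  have hε0 : ε ≠ 0 := by rcases hε with h | h <;> rw [h] <;> norm_num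
  have hq0 : q ≠ 0 := by
    rw [hq]
    exact div_ne_zero (mul_ne_zero hε0 hϖS) hua0
  have hvε : padicValRat p ε = 0 := by
    rcases hε with h | h
    · rw [h, padicValRat.one]
    · rw [h, padicValRat.neg, padicValRat.one]
  have hvua : padicValRat p |(C.u : ℚ)| = 0 := by
    rcases abs_choice (C.u : ℚ) with h | h
    · rw [h, hu]
    · rw [h, padicValRat.neg, hu]
  have hvq : padicValRat p q = padicValRat p (ϖ * S) := by
    rw [hq, padicValRat.div (mul_ne_zero hε0 hϖS) hua0, padicValRat.mul hε0 hϖS, hvε, hvua]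
    ring
  -- names for the arithmetic quantities
  set T : ℕ := Nat.card W.toAffine.Point with hT
  set c : ℕ := W.tamagawaNumberAt v₀ with hc
  set P' : ℕ := ∏ᶠ v : HeightOneSpectrum (𝓞 ℚ),
    (if (p : 𝓞 ℚ) ∈ v.asIdeal then 1 else W.tamagawaNumberAt v) with hP'
  have hT0 : T ≠ 0 := by rw [hT]; exact Nat.card_pos.ne'
  have hPsplit : W.tamagawaProduct = c * P' := tamagawaProduct_eq_tamagawaNumberAt_mul_finprod W p
  have hPpos : 0 < W.tamagawaProduct := W.tamagawaProduct_pos_holds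
  have hc0 : c ≠ 0 := fun h ↦ by rw [hPsplit, h, zero_mul] at hPpos; exact lt_irrefl 0 hPpos
  have hP'0 : P' ≠ 0 := fun h ↦ by rw [hPsplit, h, mul_zero] at hPpos; exact lt_irrefl 0 hPpos
  have hvc : padicValNat p c = 0 := padicValNat_tamagawaNumberAt_eq_zero_of_addv W p hadd hp5
  have hvP : padicValNat p W.tamagawaProduct = padicValNat p P' := by
    rw [hPsplit, padicValNat.mul hc0 hP'0, hvc, zero_add]
  have hsha : padicValNat p (Nat.card (AddCommGroup.primaryComponent W.sha p)) =
      padicValNat p W.shaOrder := by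
    unfold WeierstrassCurve.shaOrder
    exact padicValNat_card_addPrimaryComponent p
  -- the divisibility in `ℤ_p`, read as an inequality of valuations in `ℚ_p`
  set g0 : ℚ_[p] := ((PowerSeries.constantCoeff g : ℤ_[p]) : ℚ_[p]) with hg0def
  have hg0S : g0 = ((u : ℤ_[p]) : ℚ_[p]) * ((ϖ * S : ℚ) : ℚ_[p]) := by
    rw [hg0]
    push_cast
    ring
  have hϖSQ : ((ϖ * S : ℚ) : ℚ_[p]) ≠ 0 := by exact_mod_cast hϖS
  have hg0ne : g0 ≠ 0 := by
    rw [hg0S]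
    exact mul_ne_zero (coe_units_ne_zero p u) hϖSQ
  have hvg0 : g0.valuation = padicValRat p (ϖ * S) := by
    rw [hg0S, Padic.valuation_mul (coe_units_ne_zero p u) hϖSQ, valuation_coe_units_eq_zero,
      zero_add, Padic.valuation_ratCast]
  have hTQ : ((T : ℕ) : ℚ_[p]) ≠ 0 := by exact_mod_cast hT0
  obtain ⟨c', hc'⟩ := hdvd
  have hkey : g0 * ((T : ℕ) : ℚ_[p]) ^ 2 =
      (p : ℚ_[p]) ^ (padicValNat p (Nat.card (AddCommGroup.primaryComponent W.sha p)) +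
        padicValNat p P') * ((c' : ℤ_[p]) : ℚ_[p]) := by
    have h := congrArg ((↑) : ℤ_[p] → ℚ_[p]) hc'
    push_cast at h
    rw [hg0def]
    exact h
  have hlhs0 : g0 * ((T : ℕ) : ℚ_[p]) ^ 2 ≠ 0 := mul_ne_zero hg0ne (pow_ne_zero 2 hTQ)
  have hc'0 : ((c' : ℤ_[p]) : ℚ_[p]) ≠ 0 := by
    intro h0
    rw [h0, mul_zero] at hkey
    exact hlhs0 hkey
  have hpQ : (p : ℚ_[p]) ≠ 0 := by exact_mod_cast hpP.ne_zero
  have hval := congrArg Padic.valuation hkey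
  rw [Padic.valuation_mul hg0ne (pow_ne_zero 2 hTQ), Padic.valuation_pow, Padic.valuation_natCast,
    hvg0, Padic.valuation_mul (pow_ne_zero _ hpQ) hc'0, Padic.valuation_pow, Padic.valuation_p,
    mul_one, hsha] at hval
  have hc'val : 0 ≤ (((c' : ℤ_[p]) : ℚ_[p])).valuation := PadicInt.valuation_coe_nonneg
  have hineq : (padicValNat p W.shaOrder : ℤ) + padicValNat p P' ≤
      padicValRat p (ϖ * S) + 2 * (padicValNat p T : ℤ) := by
    simp only [Nat.cast_add, Nat.cast_ofNat] at hval
    linarith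
  -- conclusion
  refine ⟨q * (T : ℚ) ^ 2 / (W.tamagawaProduct : ℚ), ?_, ?_⟩
  · rw [hshaAn]
  · have hTq : (T : ℚ) ≠ 0 := by exact_mod_cast hT0
    have hPq : (W.tamagawaProduct : ℚ) ≠ 0 := by exact_mod_cast hPpos.ne'
    rw [padicValRat.div (mul_ne_zero hq0 (pow_ne_zero 2 hTq)) hPq,
      padicValRat.mul hq0 (pow_ne_zero 2 hTq), padicValRat.pow, padicValRat.of_nat,
      padicValRat.of_nat, hvq, hvP]
    simp only [Nat.cast_ofNat]
    linarith


omit [W.IsElliptic] [W.IsGloballyMinimal] in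
/-- `p ≡ 1 (mod 4)` gives `p ≥ 5`, so mod-`p` surjectivity of `E` lifts to `p`-adic surjectivity of
the twist `V` (`surj_iff_of_model_twist` + Serre's lemma `serre_hasSurjectiveModNGaloisRep_pow_holds`).
[cite: SerreAbelianLadic1968, Ch. IV §3.4, Lemma 3] -/
theorem X4RankZeroTwistEven.forall_surj_pow_twist_of_surj (hp4 : p % 4 = 1)
    (V : WeierstrassCurve ℚ) [V.IsElliptic] (C : VariableChange ℚ)
    (hC : C • V.quadraticTwist (p : ℚ) = W) (hsurj : Surj W p) (n : ℕ) :
    V.HasSurjectiveModNGaloisRep (p ^ n : ℕ) :=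
  serre_hasSurjectiveModNGaloisRep_pow_holds V p (five_le_of_prime_of_mod_four_eq_one p hp4 hp.out)
    ((surj_iff_of_model_twist V p (Nat.cast_ne_zero.mpr hp.out.ne_zero) ⟨C, hC⟩).mp hsurj) n

/-- **X4 ∧ `r_an = 0` ∧ (semistable big-image twist) at `p ≡ 1 (mod 4)`: `Typed.MissingUpperBoundAt W p`**
(`ord_p #Ш(E) ≤ ord_p #Ш_an(E)`), granted the Kato-shaped typed input `ChiBranchLeadingTermBigImageAt W p`,
for `E = W = C • V^{(p)}` in class X4 with `V` good ordinary or multiplicative at `p` and `ρ̄_{V,pⁿ}`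
onto for all `n`. Inputs otherwise: Delbourgo 1998 Prop. 4 (`hDel`), GZK, modularity, tree theorems. -/
theorem X4RankZeroTwistEven.missingUpperBoundAt
    (hDel : Delbourgo1998.prop4_rankZero_pow_dvd_constantCoeff)
    (hGZK : rank_eq_analyticRank_of_analyticRank_le_one) (hmod : hasEntireLFunction_rat)
    (hBC : ChiBranchLeadingTermBigImageAt W p)
    (hp4 : p % 4 = 1) (hr : W.analyticRank = 0) (hX : ClassX4 W p)
    (V : WeierstrassCurve ℚ) [V.IsElliptic] [V.IsGloballyMinimal]
    (C : VariableChange ℚ) (hC : C • V.quadraticTwist (p : ℚ) = W) (hV : GoodOrd V p ∨ Mult V p)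
    (hsurj : ∀ n : ℕ, V.HasSurjectiveModNGaloisRep (p ^ n : ℕ))
    {N : ℕ} [NeZero N] {f : CuspForm (Gamma0 N) 2} (hf : IsNewformOf V f)
    (ϖ : ℚ) (hϖ : (ϖ : ℝ) * V.realPeriodRat = plusPeriod f) :
    MissingUpperBoundAt W p :=
  AdditiveTwistEven.missingUpperBoundAt_of_leadingTerm W p hDel hGZK hmod hp4 hr hX.2.1 V C hC hV hf ϖ hϖ
    fun _ _ hκ hγ hγ' D ↦ (hBC V hp4 ⟨C, hC⟩ hV hsurj hκ hγ hγ' hf D ϖ hϖ).2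

/-- **The same with the image hypothesis `surj(p)` OF `E`** (`p ≡ 1 (mod 4)` forces `p ≥ 5`; Serre). -/
theorem X4RankZeroTwistEven.missingUpperBoundAt_of_surj
    (hDel : Delbourgo1998.prop4_rankZero_pow_dvd_constantCoeff)
    (hGZK : rank_eq_analyticRank_of_analyticRank_le_one) (hmod : hasEntireLFunction_rat)
    (hBC : ChiBranchLeadingTermBigImageAt W p)
    (hp4 : p % 4 = 1) (hr : W.analyticRank = 0) (hX : ClassX4 W p) (hsurj : Surj W p)
    (V : WeierstrassCurve ℚ) [V.IsElliptic] [V.IsGloballyMinimal]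
    (C : VariableChange ℚ) (hC : C • V.quadraticTwist (p : ℚ) = W) (hV : GoodOrd V p ∨ Mult V p)
    {N : ℕ} [NeZero N] {f : CuspForm (Gamma0 N) 2} (hf : IsNewformOf V f)
    (ϖ : ℚ) (hϖ : (ϖ : ℝ) * V.realPeriodRat = plusPeriod f) :
    MissingUpperBoundAt W p :=
  X4RankZeroTwistEven.missingUpperBoundAt W p hDel hGZK hmod hBC hp4 hr hX V C hC hV
    (X4RankZeroTwistEven.forall_surj_pow_twist_of_surj W p hp4 V C hC hsurj) hf ϖ hϖ

/-- **`BSD(E,p)` on the `p ∤ #Ш_an(E)` rows** of X4 ∧ `r_an = 0` ∧ (semistable twist) ∧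
`p ≡ 1 (mod 4)` ∧ `surj(p)`, granted the typed input: the one-sided bound pinches
`ord_p #Ш(E) = 0 = ord_p #Ш_an(E)`. No Kurihara number, no Manin constant, no Tamagawa hypothesis. -/
theorem X4RankZeroTwistEven.bsdp_of_surj_of_shaAn_unit
    (hDel : Delbourgo1998.prop4_rankZero_pow_dvd_constantCoeff)
    (hGZK : rank_eq_analyticRank_of_analyticRank_le_one) (hmod : hasEntireLFunction_rat)
    (hBC : ChiBranchLeadingTermBigImageAt W p)
    (hp4 : p % 4 = 1) (hr : W.analyticRank = 0) (hX : ClassX4 W p) (hsurj : Surj W p)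
    (V : WeierstrassCurve ℚ) [V.IsElliptic] [V.IsGloballyMinimal]
    (C : VariableChange ℚ) (hC : C • V.quadraticTwist (p : ℚ) = W) (hV : GoodOrd V p ∨ Mult V p)
    {N : ℕ} [NeZero N] {f : CuspForm (Gamma0 N) 2} (hf : IsNewformOf V f)
    (ϖ : ℚ) (hϖ : (ϖ : ℝ) * V.realPeriodRat = plusPeriod f)
    {q : ℚ} (hq : shaAn W = (q : ℂ)) (hv : padicValRat p q = 0) : BSDp W p :=
  bsdp_of_missingPPartAt W p hGZK (by rw [hr]; exact zero_le_one)
    (missingPPartAt_of_upper_of_shaAn_unit W p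
      (X4RankZeroTwistEven.missingUpperBoundAt_of_surj W p hDel hGZK hmod hBC hp4 hr hX hsurj V C hC hV
        hf ϖ hϖ) hq hv)

/-- **What remains of X4♯ on these pairs is the LOWER half** (`p ≡ 1 (mod 4)`, `surj(p)`), granted
the typed input: `Typed.X4.MissingInputAt W p ⟺ MissingLowerBoundAt W p`. -/
theorem X4RankZeroTwistEven.missingPPartAt_iff_lower_of_surj
    (hDel : Delbourgo1998.prop4_rankZero_pow_dvd_constantCoeff)
    (hGZK : rank_eq_analyticRank_of_analyticRank_le_one) (hmod : hasEntireLFunction_rat)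
    (hBC : ChiBranchLeadingTermBigImageAt W p)
    (hp4 : p % 4 = 1) (hr : W.analyticRank = 0) (hX : ClassX4 W p) (hsurj : Surj W p)
    (V : WeierstrassCurve ℚ) [V.IsElliptic] [V.IsGloballyMinimal]
    (C : VariableChange ℚ) (hC : C • V.quadraticTwist (p : ℚ) = W) (hV : GoodOrd V p ∨ Mult V p)
    {N : ℕ} [NeZero N] {f : CuspForm (Gamma0 N) 2} (hf : IsNewformOf V f)
    (ϖ : ℚ) (hϖ : (ϖ : ℝ) * V.realPeriodRat = plusPeriod f) :
    X4.MissingInputAt W p ↔ MissingLowerBoundAt W p :=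
  ⟨fun h ↦ (lower_and_upper_of_missingPPartAt W p h).1, fun h ↦
    missingPPartAt_of_lower_of_upper W p h
      (X4RankZeroTwistEven.missingUpperBoundAt_of_surj W p hDel hGZK hmod hBC hp4 hr hX hsurj V C hC hV
        hf ϖ hϖ)⟩

/-- **The `p ∣ #Ш_an` rows: `BSD(E,p)` from ONE finite certificate** (`ord_p #Ш_an ≤ 2k` and
`p^{2k−1} ∣ #Ш(E)`; `k = 1`: `Ш(E)[p] ≠ 0`), granted the typed input — upper half as above, lower
half by Cassels–Tate squareness (`hCT`, `missingLowerBoundAt_of_casselsTate_of_pow_dvd`). Census: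
the X4 rank-0 Ш-only rows at `p = 5` with semistable twist (harvest-2 R2 list, `#Ш_an = 25`).
[cite: SilvermanAEC2009, Thm. X.4.14] [cite: Miller2011LMS, §1 and Def. 1.1] -/
theorem X4RankZeroTwistEven.bsdp_of_surj_of_casselsTate_of_pow_dvd
    (hDel : Delbourgo1998.prop4_rankZero_pow_dvd_constantCoeff)
    (hGZK : rank_eq_analyticRank_of_analyticRank_le_one) (hmod : hasEntireLFunction_rat)
    (hCT : exists_casselsTate_pairing (K := ℚ)) (hBC : ChiBranchLeadingTermBigImageAt W p)
    (hp4 : p % 4 = 1) (hr : W.analyticRank = 0) (hX : ClassX4 W p) (hsurj : Surj W p)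
    (V : WeierstrassCurve ℚ) [V.IsElliptic] [V.IsGloballyMinimal]
    (C : VariableChange ℚ) (hC : C • V.quadraticTwist (p : ℚ) = W) (hV : GoodOrd V p ∨ Mult V p)
    {N : ℕ} [NeZero N] {f : CuspForm (Gamma0 N) 2} (hf : IsNewformOf V f)
    (ϖ : ℚ) (hϖ : (ϖ : ℝ) * V.realPeriodRat = plusPeriod f)
    {q : ℚ} (hq : shaAn W = (q : ℂ)) {k : ℕ} (hv : padicValRat p q ≤ 2 * k)
    (hdvd : p ^ (2 * k - 1) ∣ W.shaOrder) : BSDp W p :=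
  bsdp_of_missingPPartAt W p hGZK (by rw [hr]; exact zero_le_one)
    (missingPPartAt_of_lower_of_upper W p
      (missingLowerBoundAt_of_casselsTate_of_pow_dvd W p hCT (hGZK W (by rw [hr]; exact zero_le_one)).2
        hq hv hdvd)
      (X4RankZeroTwistEven.missingUpperBoundAt_of_surj W p hDel hGZK hmod hBC hp4 hr hX hsurj V C hC hV
        hf ϖ hϖ))

end AssemblyEvenBigImage

end Summit.BirchSwinnertonDyer.Rank1Residual.Additive

end
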